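import Summits.ValiantsHypothesis.ValiantsHypothesis.Theorems.BarrierLeverAnchoredDoorHitsLowerPairsXElimLeaf

/-!
# Support item `AnchoredDoorHitsLowerPairs` (stmt-ValiantsHypothesis-22510), line `anchored-peeling`:
# X-ELIMINATION CERTIFICATES FROM AN ORDERED ITEM LIST — exponents, top items and captures computed; `IsTop` and injectivity of captures automatic

Helper file (`--supports stmt-ValiantsHypothesis-22510`; cell valiant-natproofs, rung V4, 𝒟-side door (c); prover seat val-np-p1 gen 26; memo
HOME/val-np-p1/g26/MEMO-conjZ-node-valnp1-g26.md §10). Closes NO item. Sequel of `…XElimRecursion` / `…XElimLeaf`.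

The certificate constructor `XElim.XCert.step` (p699080) takes item sets `IB`, `IL`, exponent functions, a top-exponent function `d`, a capture map `cap`, and
three side conditions (`hlab` freshness, `htop` = `IsTop` on touched columns, `hinj` = captures injective). The certificate SEARCH (lab/xcert2.py) produces
only a variable `a` and an ORDERED LIST OF ITEMS (head = highest priority); everything else is determined. Here an item is written as an ANCHOR: the block
item `B` as `({a} | B)` (the new anchor it creates), a label item `ℓ` as itself (its root is not `{a}` by freshness). The exponent of an item is
`length − index`, the top item of a column is the first item of the list touching it (`topItem` = `List.find?`), its capture is `capOf`, and a column is
untouched iff no item touches it (`touchedB = false`). This file proves that with these choices `IsTop` holds for every touched column (`isTop_of_items`)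
and that the captures are AUTOMATICALLY injective on the touched columns as soon as no label of the family is rooted at `a` (`capOf_injOn`: different top
blocks give different fresh labels; the same block leaves `(L, W ∖ B)` distinct; label captures are the columns themselves). Hence the derived constructor

**`XCert.step_items a its R F`** `(hfresh) (h0 : XCert (rows ∌ a) (F.filter untouched)) (h1 : XCert (links) ((F.filter touched).image capOf)) : XCert R F`,

the form in which certificates are emitted by the search (and the interface of the planned bitmask checker, memo §10). No duplicate-freeness is needed
(`List.idxOf` takes the first occurrence).

WHAT THIS IS NOT: no certificate for a specific pair; nothing on crux stmt-ValiantsHypothesis-14610 or on `VP` versus `VNP`.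
-/

set_option linter.dupNamespace false

namespace Summit.ValiantsHypothesis.ValiantsHypothesis.Theorems.BarrierLever.AnchoredPeeling

open Finset

noncomputable section

namespace XElim

variable {h : ℕ}

/-! ## 1. Items as anchors: touching, top items, captures, exponents -/

section Items

variable (a : Fin h) (its : List (Anchor h))

/-- The item `it` touches the column `c = (L, W)`: a block item `({a}|B)` iff `B` is a block of `W`; a label item iff it is one of the labels of `c`. -/
def touchesB (it : Anchor h) (c : LCol h) : Bool :=
  if it.1 = {a} then decide (it.2 ∈ blocks c.2) else decide (it ∈ c.1)

/-- The column is touched by some item of the list. -/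
def touchedB (c : LCol h) : Bool := its.any (fun it => touchesB a it c)

/-- The top item of a column: the first item of the list touching it. -/
def topItem (c : LCol h) : Option (Anchor h) := its.find? (fun it => touchesB a it c)

/-- The capture of a column: by its top item (`capB` for a block item, itself for a label item; itself if untouched). -/
def capOf (c : LCol h) : LCol h :=
  match topItem a its c with
  | some it => if it.1 = {a} then capB a it.2 c else c
  | none => c

/-- The exponent of an item: `length − index of its first occurrence` (head = largest). -/
def expOf (it : Anchor h) : ℕ := its.length - its.idxOf it

/-- The block items of the list (the `B` of the items `({a}|B)`). -/
def blockItems : Finset (Finset (Fin h)) := ((its.filter (fun it => it.1 = {a})).map Prod.snd).toFinset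

/-- The label items of the list (the items not rooted at `{a}`). -/
def labelItems : Finset (Anchor h) := (its.filter (fun it => ¬ it.1 = {a})).toFinset

end Items

variable {a : Fin h} {its : List (Anchor h)}

/-- Membership in `blockItems`. -/
theorem mem_blockItems {B : Finset (Fin h)} : B ∈ blockItems a its ↔ ((({a} : Finset (Fin h)), B) : Anchor h) ∈ its := by
  rw [blockItems, List.mem_toFinset, List.mem_map]
  constructor
  · rintro ⟨it, hit, rfl⟩
    obtain ⟨hmem, hroot⟩ := List.mem_filter.mp hit
    have hr : it.1 = {a} := of_decide_eq_true hroot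
    rw [show it = (({a} : Finset (Fin h)), it.2) from Prod.ext hr rfl] at hmem
    exact hmem
  · intro hB; exact ⟨_, List.mem_filter.mpr ⟨hB, decide_eq_true rfl⟩, rfl⟩

/-- Membership in `labelItems`. -/
theorem mem_labelItems {ℓ : Anchor h} : ℓ ∈ labelItems a its ↔ ℓ ∈ its ∧ ℓ.1 ≠ {a} := by
  rw [labelItems, List.mem_toFinset, List.mem_filter]
  simp only [decide_eq_true_eq]

/-- `touchesB` on a block item. -/
theorem touchesB_of_root {it : Anchor h} (hr : it.1 = {a}) (c : LCol h) : touchesB a it c = decide (it.2 ∈ blocks c.2) := by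
  rw [touchesB, if_pos hr]

/-- `touchesB` on a label item. -/
theorem touchesB_of_not_root {it : Anchor h} (hr : it.1 ≠ {a}) (c : LCol h) : touchesB a it c = decide (it ∈ c.1) := by
  rw [touchesB, if_neg hr]

/-- Untouched in the sense of `…XElimStep` iff no item of the list touches the column. -/
theorem untouched_iff_touchedB (c : LCol h) : Untouched (blockItems a its) (labelItems a its) c ↔ touchedB a its c = false := by
  rw [Untouched, touchedB, List.any_eq_false]
  constructor
  · rintro ⟨hL, hB⟩ it hit htc
    by_cases hr : it.1 = {a}
    · rw [touchesB_of_root hr, decide_eq_true_eq] at htc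
      have hit' : ((({a} : Finset (Fin h)), it.2) : Anchor h) ∈ its := by
        have heq : ((({a} : Finset (Fin h)), it.2) : Anchor h) = it := Prod.ext hr.symm rfl
        rw [heq]; exact hit
      exact hB _ htc (mem_blockItems.mpr hit')
    · rw [touchesB_of_not_root hr, decide_eq_true_eq] at htc
      exact hL _ htc (mem_labelItems.mpr ⟨hit, hr⟩)
  · intro hn
    refine ⟨fun ℓ hℓ hI => ?_, fun B hB hI => ?_⟩
    · obtain ⟨hmem, hr⟩ := mem_labelItems.mp hI
      exact hn ℓ hmem (by rw [touchesB_of_not_root hr, decide_eq_true hℓ])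
    · exact hn _ (mem_blockItems.mp hI) (by rw [touchesB_of_root rfl]; exact decide_eq_true hB)

/-- The top item is `none` iff the column is untouched. -/
theorem topItem_eq_none_iff (c : LCol h) : topItem a its c = none ↔ touchedB a its c = false := by
  rw [topItem, List.find?_eq_none, touchedB, List.any_eq_false]

/-- A touched column has a top item. -/
theorem exists_topItem {c : LCol h} (hc : touchedB a its c = true) : ∃ t, topItem a its c = some t := by
  by_contra hno
  push Not at hno
  have : topItem a its c = none := Option.eq_none_iff_forall_ne_some.mpr (fun t ht => hno t ht)
  rw [(topItem_eq_none_iff c).mp this] at hc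
  exact Bool.false_ne_true hc

/-- A top item touches the column, lies in the list, and comes before every other touching item. -/
theorem topItem_spec {c : LCol h} {t : Anchor h} (ht : topItem a its c = some t) :
    touchesB a t c = true ∧ t ∈ its ∧ ∀ x ∈ its, touchesB a x c = true → its.idxOf t ≤ its.idxOf x := by
  rw [topItem, List.find?_eq_some_iff_append] at ht
  obtain ⟨hpt, as, bs, heq, has⟩ := ht
  have htnot : t ∉ as := fun hmem => by have := has t hmem; rw [hpt] at this; exact Bool.noConfusion this
  refine ⟨hpt, by rw [heq]; exact List.mem_append_right as List.mem_cons_self, fun x _ hxc => ?_⟩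
  rw [heq, List.idxOf_append_of_notMem htnot, List.idxOf_cons_eq bs rfl, Nat.add_zero]
  by_cases hxas : x ∈ as
  · have := has x hxas; rw [hxc] at this; exact Bool.noConfusion this
  · rw [List.idxOf_append_of_notMem hxas]; exact Nat.le_add_right _ _

/-- Exponents of members are positive. -/
theorem one_le_expOf {it : Anchor h} (hit : it ∈ its) : 1 ≤ expOf its it := by
  rw [expOf]; have := List.idxOf_lt_length_iff.mpr hit; omega

/-- Exponents are injective on members. -/
theorem expOf_inj {x y : Anchor h} (hx : x ∈ its) (hy : y ∈ its) (hxy : expOf its x = expOf its y) : x = y := by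
  have h1 := List.idxOf_lt_length_iff.mpr hx
  have h2 := List.idxOf_lt_length_iff.mpr hy
  rw [expOf, expOf] at hxy
  exact (List.idxOf_inj hx).mp (by omega)

/-- Earlier items have larger exponents. -/
theorem expOf_le_of_idxOf_le {x y : Anchor h} (hy : y ∈ its) (hle : its.idxOf y ≤ its.idxOf x) : expOf its x ≤ expOf its y := by
  have h2 := List.idxOf_lt_length_iff.mpr hy
  rw [expOf, expOf]; omega

/-! ## 2. `IsTop` is automatic -/

/-- **The top item data satisfies `IsTop`.** -/
theorem isTop_of_items {c : LCol h} {t : Anchor h} (ht : topItem a its c = some t) :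
    IsTop a (blockItems a its) (labelItems a its) (fun B => expOf its ((({a} : Finset (Fin h)), B) : Anchor h)) (fun ℓ => expOf its ℓ) c
      (expOf its t) (capOf a its c) := by
  classical
  obtain ⟨htc, htm, hfirst⟩ := topItem_spec ht
  have hcap : capOf a its c = (if t.1 = {a} then capB a t.2 c else c) := by rw [capOf, ht]
  refine ⟨one_le_expOf htm, fun ℓ hℓ hI => ?_, fun B hB hI => ?_, ?_⟩
  · obtain ⟨hmem, hr⟩ := mem_labelItems.mp hI
    exact expOf_le_of_idxOf_le htm (hfirst _ hmem (by rw [touchesB_of_not_root hr, decide_eq_true hℓ]))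
  · exact expOf_le_of_idxOf_le htm (hfirst _ (mem_blockItems.mp hI) (by rw [touchesB_of_root rfl]; exact decide_eq_true hB))
  by_cases hr : t.1 = {a}
  · -- block top `t = ({a} | B₀)`
    right
    have hteq : t = ((({a} : Finset (Fin h)), t.2) : Anchor h) := Prod.ext hr rfl
    rw [touchesB_of_root hr, decide_eq_true_eq] at htc
    refine ⟨?_, t.2, htc, mem_blockItems.mpr (hteq ▸ htm), by show expOf its _ = expOf its t; rw [← hteq], fun B hB hI heq => ?_, by rw [hcap, if_pos hr]⟩
    · rw [Finset.card_eq_zero, Finset.filter_eq_empty_iff]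
      rintro ℓ hℓ ⟨hI, heq⟩
      obtain ⟨hmem, hrℓ⟩ := mem_labelItems.mp hI
      exact hrℓ (by rw [expOf_inj hmem htm heq]; exact hr)
    · have := expOf_inj (mem_blockItems.mp hI) htm heq
      rw [hteq] at this
      exact (Prod.mk.inj this).2
  · -- label top
    left
    rw [touchesB_of_not_root hr, decide_eq_true_eq] at htc
    refine ⟨?_, fun B hB hI heq => hr ?_, by rw [hcap, if_neg hr]⟩
    · rw [Finset.card_eq_one]
      refine ⟨t, Finset.eq_singleton_iff_unique_mem.mpr ⟨Finset.mem_filter.mpr ⟨htc, mem_labelItems.mpr ⟨htm, hr⟩, rfl⟩, fun ℓ hℓ => ?_⟩⟩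
      obtain ⟨_, hI, heq⟩ := Finset.mem_filter.mp hℓ
      exact expOf_inj (mem_labelItems.mp hI).1 htm heq
    · rw [← expOf_inj (mem_blockItems.mp hI) htm heq]

/-! ## 3. Captures are injective under freshness -/

/-- **Captures are injective on the touched columns of a family with no label rooted at `a`.** -/
theorem capOf_injOn {F : Finset (LCol h)} (hfresh : ∀ c ∈ F, ∀ ℓ ∈ c.1, ℓ.1 ≠ {a}) {c c' : LCol h} (hc : c ∈ F) (hc' : c' ∈ F)
    (htc : touchedB a its c = true) (htc' : touchedB a its c' = true) (heq : capOf a its c = capOf a its c') : c = c' := by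
  classical
  obtain ⟨t, ht⟩ := exists_topItem htc
  obtain ⟨t', ht'⟩ := exists_topItem htc'
  have hcap : capOf a its c = (if t.1 = {a} then capB a t.2 c else c) := by rw [capOf, ht]
  have hcap' : capOf a its c' = (if t'.1 = {a} then capB a t'.2 c' else c') := by rw [capOf, ht']
  -- a fresh label `({a}|B)` is in no column of `F`
  have hnot : ∀ {c₁ : LCol h}, c₁ ∈ F → ∀ B : Finset (Fin h), ((({a} : Finset (Fin h)), B) : Anchor h) ∉ c₁.1 :=
    fun hc₁ B hmem => hfresh _ hc₁ _ hmem rfl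
  rw [hcap, hcap'] at heq
  by_cases hr : t.1 = {a} <;> by_cases hr' : t'.1 = {a}
  · -- block / block
    rw [if_pos hr, if_pos hr'] at heq
    simp only [capB] at heq
    obtain ⟨h1, h2⟩ := Prod.mk.inj heq
    have hBB : t.2 = t'.2 := by
      have hmem : ((({a} : Finset (Fin h)), t.2) : Anchor h) ∈ insert (({a} : Finset (Fin h)), t'.2) c'.1 := by rw [← h1]; exact Finset.mem_insert_self _ _
      rcases Finset.mem_insert.mp hmem with hx | hx
      · exact (Prod.mk.inj hx).2
      · exact absurd hx (hnot hc' t.2)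
    have htB := (topItem_spec ht).1
    have htB' := (topItem_spec ht').1
    rw [touchesB_of_root hr, decide_eq_true_eq] at htB
    rw [touchesB_of_root hr', decide_eq_true_eq] at htB'
    have hB₀ : t.2 ⊆ c.2 := (mem_blocks.mp htB).1
    have hB₀' : t.2 ⊆ c'.2 := by rw [hBB]; exact (mem_blocks.mp htB').1
    rw [← hBB] at h1 h2
    refine Prod.ext ?_ ?_
    · ext ℓ
      constructor
      · intro hℓ
        have : ℓ ∈ insert (({a} : Finset (Fin h)), t.2) c'.1 := by rw [← h1]; exact Finset.mem_insert_of_mem hℓ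
        rcases Finset.mem_insert.mp this with rfl | hx
        · exact absurd hℓ (hnot hc t.2)
        · exact hx
      · intro hℓ
        have : ℓ ∈ insert (({a} : Finset (Fin h)), t.2) c.1 := by rw [h1]; exact Finset.mem_insert_of_mem hℓ
        rcases Finset.mem_insert.mp this with rfl | hx
        · exact absurd hℓ (hnot hc' t.2)
        · exact hx
    · rw [← Finset.sdiff_union_of_subset hB₀, ← Finset.sdiff_union_of_subset hB₀', h2]
  · -- block / label: the block capture carries a fresh label, the label capture is `c'` itself
    rw [if_pos hr, if_neg hr'] at heq
    simp only [capB] at heq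
    have : ((({a} : Finset (Fin h)), t.2) : Anchor h) ∈ c'.1 := by rw [← heq]; exact Finset.mem_insert_self _ _
    exact absurd this (hnot hc' t.2)
  · rw [if_neg hr, if_pos hr'] at heq
    simp only [capB] at heq
    have : ((({a} : Finset (Fin h)), t'.2) : Anchor h) ∈ c.1 := by rw [heq]; exact Finset.mem_insert_self _ _
    exact absurd this (hnot hc t'.2)
  · rw [if_neg hr, if_neg hr'] at heq
    exact heq

/-! ## 4. The derived constructor -/

/-- **CERTIFICATE STEP FROM AN ORDERED ITEM LIST.** Given a variable `a`, an item list `its` (anchors: `({a}|B)` = block item, otherwise label item),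
freshness of the labels of `F` at `a`, a certificate for TOP = (rows avoiding `a`; untouched columns) and one for BOT = (link rows; captures of the touched
columns), the pair `(R, F)` is certified. -/
theorem XCert.step_items (a : Fin h) (its : List (Anchor h)) (R : Finset (Finset (Fin h))) (F : Finset (LCol h))
    (hfresh : ∀ c ∈ F, ∀ ℓ ∈ c.1, ℓ.1 ≠ {a})
    (h0 : XCert (R.filter (fun U => a ∉ U)) (F.filter (fun c => touchedB a its c = false)))
    (h1 : XCert ((R.filter (fun U => a ∈ U)).image (fun U => U.erase a)) ((F.filter (fun c => touchedB a its c = true)).image (capOf a its))) :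
    XCert R F := by
  classical
  have hF0 : F.filter (fun c => Untouched (blockItems a its) (labelItems a its) c) = F.filter (fun c => touchedB a its c = false) :=
    Finset.filter_congr (fun c _ => untouched_iff_touchedB c)
  have hF1 : F.filter (fun c => ¬ Untouched (blockItems a its) (labelItems a its) c) = F.filter (fun c => touchedB a its c = true) :=
    Finset.filter_congr (fun c _ => by rw [untouched_iff_touchedB, Bool.not_eq_false])
  refine XCert.step a R F (blockItems a its) (labelItems a its) (fun B => expOf its ((({a} : Finset (Fin h)), B) : Anchor h)) (fun ℓ => expOf its ℓ)
    (fun c => match topItem a its c with | some t => expOf its t | none => 0) (capOf a its) hfresh ?_ ?_ ?_ ?_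
  · intro c _ hn
    rw [untouched_iff_touchedB, Bool.not_eq_false] at hn
    obtain ⟨t, ht⟩ := exists_topItem hn
    have hd : (match topItem a its c with | some t => expOf its t | none => 0) = expOf its t := by rw [ht]
    rw [hd]
    exact isTop_of_items ht
  · intro c hc c' hc' hn hn' heq
    rw [untouched_iff_touchedB, Bool.not_eq_false] at hn hn'
    exact capOf_injOn hfresh hc hc' hn hn' heq
  · rw [hF0]; exact h0
  · rw [hF1]; exact h1

end XElim

end

end Summit.ValiantsHypothesis.ValiantsHypothesis.Theorems.BarrierLever.AnchoredPeeling
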